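import Summits.NavierStokesRegularity.NavierStokesRegularity.Theses.PalasekTowerBreakdown
import Summits.NavierStokesRegularity.FluidComputer.PalasekTowerGermHostSliceDoorAt
import Summits.NavierStokesRegularity.FluidComputer.PalasekTowerTameCarrierAt

/-!
# `EpisodeBaseT` (crux stmt-NavierStokesRegularity-20303, the RE-BASED K1 at `TowerRates.tuned`) from ANY
# strict-slot filler at `tuned` and ONE run of the first tuned window from its profile — BY NAME

Cell `ns-blowup`, seat `ns-blowup-ecbridge-3` (g8; D-0074 GROUP C «BRIDGE SUPPORT», lineage `host_preparation`).
Route `PalasekTowerBreakdown` after the RE-BASE (rev 19, 2026-08-27T10:23Z): `EpisodeBaseT :=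
EpisodeBaseGAt TowerRates.tuned`. LABEL: E–C typing (KERNEL: theorems only; `--supports`
stmt-NavierStokesRegularity-20303). WHAT THIS IS NOT: not Navier–Stokes evidence — no run of the first tuned
window is exhibited; `EpisodeBaseT` appears only as the conclusion of conditionals; nothing about `RungG 1` or
blow-up is asserted.

The door port of this generation (layers L0–L4a: `PalasekTowerRegisterWindowTuned` p525464,
`PalasekTowerBoxScheduleAt` p526018, `PalasekTowerGermHostAt` p527545, `PalasekTowerTameCarrierAt` p528399,
`PalasekTowerTameCarrierAtRun` p529339, `PalasekTowerGermHostSliceDoorAt` p530054) read at the route's decl: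

* `palasekTowerBreakdown_episodeBaseT_of_levelZeroDataAt_sliceRun` — ANY profile `U` in the strict slot at
  `tuned` (`Germ.LevelZeroDataAt TowerRates.tuned U ρ`), a push constant `c₄ ∈ (0, 1]`, and ONE classical
  finite-energy solution of Navier–Stokes at unit viscosity on the first tuned window `[1, τ₁(tuned)]` forced by
  the germ schedule's fading force (`≤ c₄Y₀`, zero from `1 + ε` on) FROM `v 1 = U`, below `(5/3)Y₁`, showing at
  `τ₁(tuned)` in `B̄(0, ρ)` speed `≥ Y₁`, gradient `≥ A₁`, an `N₁`-core loop of circulation `≥ N₁^{β−2}` (all at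
  the tuned numbers) ⟹ `EpisodeBaseT`;
* `palasekTowerBreakdown_episodeBaseT_of_tameCarrierAt_sliceRun` — the same with the profile FIXED to the
  tame carrier `Germ.tameCarrierAt TowerRates.tuned a λ` (`0 < a ≤ 5/256 ∧ 5/N₀ ∧ strainConst/N₀`, `0 < λ ≤ 1`):
  the tuned crux's first child (host preparation) is discharged for a named family of designs, and what is
  left is ONE Cauchy problem on the first tuned window.

References: S. Palasek, arXiv:2605.13827 §4 [cite: Palasek2026ElementaryModel, §4]; H. Sohr, *The
Navier–Stokes Equations*, Birkhäuser 2001, Ch. V Thm. 1.5.1 [cite: Sohr2001, Ch. V Thm. 1.5.1].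
-/

noncomputable section

-- `Summit.<Summit>.<Problem>` is the tree's mandated summit-side namespace (CONVENTIONS §2); for this
-- single-conjunct summit the two coincide, so the duplicate is deliberate.
set_option linter.dupNamespace false

namespace Summit.NavierStokesRegularity.NavierStokesRegularity.Theorems

open Set Function MeasureTheory Metric
open scoped ENNReal ContDiff
open Summit.NavierStokesRegularity.NavierStokesRegularity.Theses
open Summit.NavierStokesRegularity.FluidComputer.PalasekTowerClayBridge
open Summit.NavierStokesRegularity.FluidComputer.PalasekTowerClayBridge.Germ
open Literature.Analysis.FluidPDE

/-- **`EpisodeBaseT` FROM ANY TUNED STRICT-SLOT FILLER AND ONE SLICE RUN.** Let `h : Germ.LevelZeroDataAt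
TowerRates.tuned U ρ` (smooth, divergence free, supported in `B̄(0, ρ)`, speed `≤ Y₀` with equality attained,
strain `≥ A₀`, an `N₀`-core, strict anchor test — all at the tuned numbers), `c₄ ∈ (0, 1]`, and let `(v, q)` be a
classical finite-energy solution of Navier–Stokes at unit viscosity on `[1, Host.τfirstAt tuned]` forced by the
germ schedule's fading force `h.force hc₄`, with `v 1 = U`, `‖v‖ ≤ (5/3) Y₁` on the window, and at
`Host.τfirstAt tuned`, in `B̄(0, ρ)`: speed `≥ Y₁`, gradient `≥ A₁`, an `N₁`-core loop with circulation `≥ N₁^{β−2}`.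
Then `EpisodeBaseT`. [cite: Palasek2026ElementaryModel, §4] [cite: Sohr2001, Ch. V Thm. 1.5.1] -/
theorem palasekTowerBreakdown_episodeBaseT_of_levelZeroDataAt_sliceRun
    {U : EuclideanSpace ℝ (Fin 3) → EuclideanSpace ℝ (Fin 3)} {ρ : ℝ} (h : LevelZeroDataAt TowerRates.tuned U ρ)
    {c₄ : ℝ} (hc₄ : 0 < c₄) (hc₄' : c₄ ≤ 1)
    {v : ℝ → EuclideanSpace ℝ (Fin 3) → EuclideanSpace ℝ (Fin 3)} {q : ℝ → EuclideanSpace ℝ (Fin 3) → ℝ}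
    (hcl : IsClassicalNSSolutionOn (Icc 1 (Host.τfirstAt TowerRates.tuned)) 1 (h.force hc₄) v q) (h1 : v 1 = U)
    (henergy : ∃ C : ℝ≥0∞, C < ⊤ ∧ ∀ t ∈ Icc (1 : ℝ) (Host.τfirstAt TowerRates.tuned), ∫⁻ x, ‖v t x‖ₑ ^ 2 ≤ C)
    (hceil : ∀ t ∈ Icc (1 : ℝ) (Host.τfirstAt TowerRates.tuned), ∀ x, ‖v t x‖ ≤ 5 / 3 * TowerRates.tuned.Y 1)
    (hfloor : ∃ x, ‖x‖ ≤ ρ ∧ TowerRates.tuned.Y 1 ≤ ‖v (Host.τfirstAt TowerRates.tuned) x‖)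
    (hstrain : ∃ x, ‖x‖ ≤ ρ ∧ TowerRates.tuned.A 1 ≤ ‖fderiv ℝ (v (Host.τfirstAt TowerRates.tuned)) x‖)
    (hcore : ∃ (x : EuclideanSpace ℝ (Fin 3)) (γ : ℝ → EuclideanSpace ℝ (Fin 3)),
      ‖x‖ ≤ ρ ∧ ContDiff ℝ 1 γ ∧ γ 0 = γ 1 ∧
      (∀ s ∈ Icc (0 : ℝ) 1, γ s ∈ closedBall x (1 / TowerRates.tuned.N 1)) ∧
      (∀ s ∈ Icc (0 : ℝ) 1, ‖deriv γ s‖ ≤ 8 * Real.pi / TowerRates.tuned.N 1) ∧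
      TowerRates.tuned.N 1 ^ (TowerRates.tuned.β - 2) ≤ circulation (v (Host.τfirstAt TowerRates.tuned)) γ) :
    PalasekTowerBreakdown.EpisodeBaseT := by
  unfold PalasekTowerBreakdown.EpisodeBaseT
  exact h.episodeBaseGAt_tuned_of_sliceRun hc₄ hc₄' hcl h1 henergy hceil hfloor hstrain hcore

/-- **`EpisodeBaseT` FROM ONE SLICE RUN OF A TAME CARRIER AT `tuned`** (`Germ.tameCarrierAt TowerRates.tuned a λ`
with `0 < a ≤ 5/256`, `a ≤ 5/N₀`, `a ≤ strainConst/N₀`, `0 < λ ≤ 1`; `Germ.levelZeroDataAt_tameCarrierAt`): one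
classical finite-energy run of the first tuned window under its germ schedule's fading force from the carrier,
below `(5/3) Y₁`, with the three level-`1` floors at `Host.τfirstAt tuned` in `B̄(0, 7)` ⟹ `EpisodeBaseT`.
[cite: Palasek2026ElementaryModel, §4] -/
theorem palasekTowerBreakdown_episodeBaseT_of_tameCarrierAt_sliceRun {a lam : ℝ} (ha : 0 < a)
    (h5 : a ≤ 5 / 256) (h5N : a ≤ 5 / TowerRates.tuned.N 0) (hκ : a ≤ TinyBlob.strainConst / TowerRates.tuned.N 0)
    (hlam : 0 < lam) (hlam1 : lam ≤ 1) {c₄ : ℝ} (hc₄ : 0 < c₄) (hc₄' : c₄ ≤ 1)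
    {v : ℝ → EuclideanSpace ℝ (Fin 3) → EuclideanSpace ℝ (Fin 3)} {q : ℝ → EuclideanSpace ℝ (Fin 3) → ℝ}
    (hcl : IsClassicalNSSolutionOn (Icc 1 (Host.τfirstAt TowerRates.tuned)) 1
      ((levelZeroDataAt_tameCarrierAt (R := TowerRates.tuned) ha h5 h5N hκ hlam hlam1).force hc₄) v q)
    (h1 : v 1 = tameCarrierAt TowerRates.tuned a lam)
    (henergy : ∃ C : ℝ≥0∞, C < ⊤ ∧ ∀ t ∈ Icc (1 : ℝ) (Host.τfirstAt TowerRates.tuned), ∫⁻ x, ‖v t x‖ₑ ^ 2 ≤ C)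
    (hceil : ∀ t ∈ Icc (1 : ℝ) (Host.τfirstAt TowerRates.tuned), ∀ x, ‖v t x‖ ≤ 5 / 3 * TowerRates.tuned.Y 1)
    (hfloor : ∃ x, ‖x‖ ≤ 7 ∧ TowerRates.tuned.Y 1 ≤ ‖v (Host.τfirstAt TowerRates.tuned) x‖)
    (hstrain : ∃ x, ‖x‖ ≤ 7 ∧ TowerRates.tuned.A 1 ≤ ‖fderiv ℝ (v (Host.τfirstAt TowerRates.tuned)) x‖)
    (hcore : ∃ (x : EuclideanSpace ℝ (Fin 3)) (γ : ℝ → EuclideanSpace ℝ (Fin 3)),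
      ‖x‖ ≤ 7 ∧ ContDiff ℝ 1 γ ∧ γ 0 = γ 1 ∧
      (∀ s ∈ Icc (0 : ℝ) 1, γ s ∈ closedBall x (1 / TowerRates.tuned.N 1)) ∧
      (∀ s ∈ Icc (0 : ℝ) 1, ‖deriv γ s‖ ≤ 8 * Real.pi / TowerRates.tuned.N 1) ∧
      TowerRates.tuned.N 1 ^ (TowerRates.tuned.β - 2) ≤ circulation (v (Host.τfirstAt TowerRates.tuned)) γ) :
    PalasekTowerBreakdown.EpisodeBaseT :=
  palasekTowerBreakdown_episodeBaseT_of_levelZeroDataAt_sliceRun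
    (levelZeroDataAt_tameCarrierAt (R := TowerRates.tuned) ha h5 h5N hκ hlam hlam1) hc₄ hc₄' hcl h1 henergy hceil
    hfloor hstrain hcore

end Summit.NavierStokesRegularity.NavierStokesRegularity.Theorems

end
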